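import Summits.Langlands.Langlands.Theses.DedekindQuotient1951
import Summits.Langlands.Langlands.Theorems.QuarterDeficit1951IcosahedralSupplyAway
import Summits.Langlands.Langlands.Theorems.DedekindQuotient1951DoudMoorePermutationSupplyGroupTheory
import Summits.Langlands.Langlands.Theorems.DedekindQuotient1951DoudMoorePermutationSupplyHyperplane
import Summits.Langlands.Langlands.Theorems.DedekindQuotient1951DoudMoorePermutationSupplyField
import Summits.Langlands.Langlands.Theorems.DedekindQuotient1951DoudMoorePermutationSupplyPermRep

/-!
# Route `DedekindQuotient1951` (Langlands) — support `DoudMoorePermutationSupply` (stmt-Langlands-17272)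

**The Doud–Moore permutation supply, proved.**  For every reciprocity datum `RD` of `ℚ` and every
prime `ℓ ≠ 1951` there are an irreducible `ρ : Γ_ℚ → GL₄(ℚ̄_ℓ)`, geometric in the summit's sense, and
the quintic field `K = ℚ(θ)` of the Doud–Moore polynomial `x⁵ − x⁴ − 780x³ + 9911x² − 24208x + 15952`,
such that at every place `v` with `N v ≠ 1951` the representation `ρ` is unramified with Frobenius
characteristic polynomial `Q_v` satisfying `(X − 1) · Q_v = ∏_{𝔭 ∣ N v} (X^{f(𝔭)} − 1)` in `𝓞_K`.

Construction: `K` is the degree-`5` field generated by a root (`exists_dmField`; irreducibility from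
the `5`-cycle in the Galois image, `natDegree_minpoly_dm`); `P = Ind_{Γ_K}^{Γ_ℚ} 1` is the permutation
representation on the five cosets (`…PermRep`); `ρ` is its restriction to the sum-zero hyperplane
(`exists_hyperplaneRep`, so `(X − 1) · det(X − ρ) = det(X − P)`).  Unramifiedness away from `1951`
and the Frobenius polynomials `∏_{w ∣ v} (X^{f(w|v)} − 1)` of `P` are Dedekind's theorem
(`hasFrobCharpolyAt_permRep`, from the tree's `FramedGaloisRep.hasFrobCharpolyAt_induce`) together
with `stub_dmUnramified` (inertia away from `1951` fixes the roots, hence lies in `res(Γ_K)`);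
geometricity is `isGeometricFramed_of_unramified_away` (`ℓ ≠ 1951`); irreducibility: the coset
action has the same kernel as the root action `e₀`, whose image contains elements of order `5` and
`3`, so the image contains `A₅` (`alternatingGroup_le_of_orderOf`), and the standard representation
of `A₅` on the sum-zero hyperplane is irreducible (`eq_bot_or_forall_mem_of_alternating_stable`).

References: D. Doud, M. W. Moore, J. Number Theory 118 (2006) §4; J. Neukirch, *Algebraic Number
Theory* (1999), I §8–§9; J.-P. Serre, *Linear representations of finite groups*, §2.3, §3.3.
-/

set_option linter.dupNamespace false

noncomputable section

open scoped NumberField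
open Polynomial Matrix IsDedekindDomain Field
open Literature.NumberTheory.GaloisRepresentations

namespace Summit.Langlands.Langlands.Theorems.DedekindQuotient1951

/-- Irreducibility of a representation from "every stable subspace is `⊥` or `⊤`". [folklore] -/
theorem isIrreducible_of_forall_submodule {k G V : Type*} [Field k] [Monoid G] [AddCommGroup V]
    [Module k V] [Nontrivial V] (r : Representation k G V)
    (h : ∀ W : Submodule k V, (∀ g, ∀ u ∈ W, r g u ∈ W) → W = ⊥ ∨ W = ⊤) : r.IsIrreducible := by
  have hb : (⊥ : Subrepresentation r).toSubmodule = ⊥ := rfl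
  have ht : (⊤ : Subrepresentation r).toSubmodule = ⊤ := rfl
  haveI : Nontrivial (Subrepresentation r) := ⟨⟨⊥, ⊤, fun e => by
    have e' := congrArg Subrepresentation.toSubmodule e
    rw [hb, ht] at e'
    exact bot_ne_top e'⟩⟩
  refine ⟨fun W => ?_⟩
  rcases h W.toSubmodule (fun g u hu => W.apply_mem_toSubmodule g hu) with h' | h'
  · exact Or.inl (Subrepresentation.toSubmodule_injective (by rw [h', hb]))
  · exact Or.inr (Subrepresentation.toSubmodule_injective (by rw [h', ht]))

/-- **The `4`-dimensional constituent of a permutation representation with image `⊇ A₅` is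
irreducible.**  Let `P : G → GL₅(A)` (`A` a field of characteristic `0`) be a framed representation
all of whose matrices are permutation matrices `[p_g j = i]` for a homomorphism `p : G → S₅` whose
image contains `A₅`, and `ρ : G → GL₄(A)` a framed representation with matrices the hyperplane
blocks of those of `P`.  Then `ρ` is irreducible: a `ρ`-stable subspace lifts, through
`u ↦ (−∑ u, u)`, to an `A₅`-stable subspace of the sum-zero hyperplane. [folklore] -/
theorem isIrreducible_hyperplane_of_alternating_le {G : Type*} [Group G] [TopologicalSpace G]
    {A : Type*} [Field A] [CharZero A] [TopologicalSpace A]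
    (P : FramedRep G A 5) (p : G →* Equiv.Perm (Fin 5))
    (hP : ∀ g i j, ((P g : GL (Fin 5) A) : Matrix (Fin 5) (Fin 5) A) i j = if p g j = i then 1 else 0)
    (hp : alternatingGroup (Fin 5) ≤ p.range) (ρ : FramedRep G A 4)
    (hρ : ∀ g, ((ρ g : GL (Fin 4) A) : Matrix (Fin 4) (Fin 4) A) = Matrix.of fun j k : Fin 4 =>
      ((P g : GL (Fin 5) A) : Matrix (Fin 5) (Fin 5) A) j.succ k.succ -
        ((P g : GL (Fin 5) A) : Matrix (Fin 5) (Fin 5) A) j.succ 0) :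
    ρ.IsIrreducible := by
  have hcol : ∀ g k, ∑ j, ((P g : GL (Fin 5) A) : Matrix (Fin 5) (Fin 5) A) j k = 1 :=
    fun g => sum_of_perm _ _ (hP g)
  -- the lift `u ↦ (−∑ u, u)` to the sum-zero hyperplane
  let T : (Fin 4 → A) →ₗ[A] (Fin 5 → A) :=
    { toFun := fun u => Fin.cons (-∑ k, u k) u
      map_add' := fun u u' => by
        funext i
        refine Fin.cases ?_ (fun k => ?_) i
        · simp only [Fin.cons_zero, Pi.add_apply, Finset.sum_add_distrib, neg_add]
        · simp only [Fin.cons_succ, Pi.add_apply]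
      map_smul' := fun c u => by
        funext i
        refine Fin.cases ?_ (fun k => ?_) i
        · simp only [Fin.cons_zero, Pi.smul_apply, smul_eq_mul, Finset.mul_sum, RingHom.id_apply,
            mul_neg]
        · simp only [Fin.cons_succ, Pi.smul_apply, RingHom.id_apply] }
  have hT : ∀ u, T u = Fin.cons (-∑ k, u k) u := fun u => rfl
  have hTsucc : ∀ u (k : Fin 4), T u k.succ = u k := fun u k => by rw [hT, Fin.cons_succ]
  have hTinj : ∀ u u', T u = T u' → u = u' := fun u u' h => by
    funext k; rw [← hTsucc u k, ← hTsucc u' k, h]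
  have hTsum : ∀ u, ∑ i, T u i = 0 := fun u => by rw [hT, Fin.sum_cons, neg_add_cancel]
  refine isIrreducible_of_forall_submodule _ fun W hW => ?_
  -- the lifted subspace is `A₅`-stable and contained in the sum-zero hyperplane
  set W' : Submodule A (Fin 5 → A) := W.map T with hW'
  have hW'₀ : ∀ x ∈ W', ∑ i, x i = 0 := by
    rintro x ⟨u, -, rfl⟩
    exact hTsum u
  have hW'st : ∀ q ∈ alternatingGroup (Fin 5), ∀ x ∈ W', (fun i => x (q⁻¹ i)) ∈ W' := by
    rintro q hq x ⟨u, hu, rfl⟩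
    obtain ⟨g, rfl⟩ := hp hq
    refine ⟨(Matrix.of fun j k : Fin 4 =>
      ((P g : GL (Fin 5) A) : Matrix (Fin 5) (Fin 5) A) j.succ k.succ -
        ((P g : GL (Fin 5) A) : Matrix (Fin 5) (Fin 5) A) j.succ 0) *ᵥ u, ?_, ?_⟩
    · have := hW g u hu
      rwa [FramedRep.toRepresentation_apply_apply, hρ] at this
    · rw [hT, ← mulVec_cons_neg_sum _ (hcol g) u, ← hT, mulVec_of_perm (p g) _ (hP g)]
  rcases eq_bot_or_forall_mem_of_alternating_stable W' hW'₀ hW'st with h | h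
  · left
    rw [Submodule.eq_bot_iff]
    intro u hu
    have hTu : T u ∈ W' := ⟨u, hu, rfl⟩
    rw [h, Submodule.mem_bot] at hTu
    apply hTinj
    rw [hTu, map_zero]
  · right
    rw [Submodule.eq_top_iff']
    intro u
    obtain ⟨u', hu', he⟩ := h (T u) (hTsum u)
    rwa [← hTinj _ _ he]

/-- **Doud–Moore permutation supply** (item `stmt-Langlands-17272`, support of route
`DedekindQuotient1951`): for every reciprocity datum `RD` of `ℚ` and every prime `ℓ ≠ 1951`, the
restriction `ρ` to the sum-zero hyperplane of the permutation representation of `Γ_ℚ` on the roots of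
the Doud–Moore quintic is an irreducible, geometric `ρ : Γ_ℚ → GL₄(ℚ̄_ℓ)`, unramified at every
`v ∤ 1951` with `(X − 1) · charpoly(ρ(Frob_v)) = ∏_{𝔭 ∣ N v} (X^{f(𝔭)} − 1)` in the ring of integers of
`K = ℚ(θ)` (Dedekind's theorem). [cite: DoudMoore2006, §4 (Table, p = 1951)]
[cite: NeukirchANT1999, I §8 (8.3), I §9] -/
theorem DoudMoorePermutationSupply_proof :
    Summit.Langlands.Langlands.Theses.DedekindQuotient1951.DoudMoorePermutationSupply := by
  intro RD ℓ _ hℓ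
  classical
  -- the roots and the field
  obtain ⟨θ, e₀, hroot, hinj, hall, he₀, hunr, h5, h3⟩ := dm_rootDatum
  have hα : ((θ 0 : absIntegers (𝓞 ℚ) ℚ) : AlgebraicClosure ℚ) ^ 5 -
      ((θ 0 : absIntegers (𝓞 ℚ) ℚ) : AlgebraicClosure ℚ) ^ 4 -
      780 * ((θ 0 : absIntegers (𝓞 ℚ) ℚ) : AlgebraicClosure ℚ) ^ 3 +
      9911 * ((θ 0 : absIntegers (𝓞 ℚ) ℚ) : AlgebraicClosure ℚ) ^ 2 -
      24208 * ((θ 0 : absIntegers (𝓞 ℚ) ℚ) : AlgebraicClosure ℚ) + 15952 = 0 := by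
    have h := congrArg (Subtype.val : absIntegers (𝓞 ℚ) ℚ → AlgebraicClosure ℚ) (hroot 0)
    rw [ZeroMemClass.coe_zero] at h
    push_cast at h
    exact h
  obtain ⟨K, _, _, θK, hθK, hgen, hK5⟩ :=
    exists_dmField _ hα (natDegree_minpoly_dm hroot hinj he₀ h5 0)
  -- the permutation representation and its hyperplane constituent
  set P : FramedGaloisRep ℚ (PadicAlgCl ℓ) 5 :=
    FramedRep.reindex (finProdFinEquiv.symm.trans (Equiv.prodUnique (Fin 5) (Fin 1)))
      ((1 : FramedGaloisRep K (PadicAlgCl ℓ) 1).induce ℚ hK5) with hPdef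
  have hcol : ∀ (σ : absoluteGaloisGroup ℚ) (k : Fin 5),
      ∑ j, ((P σ : GL (Fin 5) (PadicAlgCl ℓ)) : Matrix (Fin 5) (Fin 5) (PadicAlgCl ℓ)) j k = 1 :=
    sum_permRep K hK5 (PadicAlgCl ℓ)
  obtain ⟨ρ, hρ⟩ := exists_hyperplaneRep P hcol
  -- inertia away from `1951` lies in `res(Γ_K)`
  have hI : ∀ v : HeightOneSpectrum (𝓞 ℚ), v.residueCard ≠ 1951 → ∀ 𝔓 ∈ v.primesAbove,
      𝔓.inertia (absoluteGaloisGroup ℚ) ≤ (absGaloisRestrict ℚ K).range :=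
    fun v hv => inertia_le_range_absGaloisRestrict_dm hall hunr hθK hgen hv
  -- unramified away from `1951`
  have hunrρ : ∀ v : HeightOneSpectrum (𝓞 ℚ), v.residueCard ≠ 1951 →
      FramedGaloisRep.IsUnramifiedAt v ρ := by
    intro v hv 𝔓 h𝔓 σ hσ
    have h1 : P σ = 1 := isUnramifiedAt_permRep K hK5 (PadicAlgCl ℓ) (hI v hv) 𝔓 h𝔓 σ hσ
    apply Units.ext
    rw [hρ, h1, Units.val_one, Units.val_one, hypMat_one]
  -- `(X - 1) · det(X - ρ σ) = det(X - P σ)`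
  have hchar : ∀ σ : absoluteGaloisGroup ℚ,
      (X - C 1) * FramedRep.charpoly ρ σ = FramedRep.charpoly P σ := fun σ => by
    rw [FramedRep.charpoly, FramedRep.charpoly, hρ, Polynomial.C_1,
      charpoly_eq_X_sub_one_mul_charpoly_hypMat _ (hcol σ)]
  refine ⟨ρ, K, inferInstance, inferInstance, θK, hθK, hgen, ?_, ?_, ?_⟩
  · -- irreducible: the coset action has the same kernel as `e₀`, so its image contains `A₅`
    set q : absoluteGaloisGroup ℚ →* Equiv.Perm (Fin 5) :=
      (Equiv.permCongrHom (absGaloisCosetEquiv ℚ K hK5)).toMonoidHom.comp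
        (MulAction.toPermHom (absoluteGaloisGroup ℚ)
          (absoluteGaloisGroup ℚ ⧸ (absGaloisRestrict ℚ K).range)) with hqdef
    have hq : ∀ σ, q σ = Equiv.permCongrHom (absGaloisCosetEquiv ℚ K hK5)
        (MulAction.toPerm σ :
          Equiv.Perm (absoluteGaloisGroup ℚ ⧸ (absGaloisRestrict ℚ K).range)) := fun σ => rfl
    have hker : ∀ σ, q σ = 1 ↔ e₀ σ = 1 := fun σ => by
      rw [hq, permCongr_toPerm_eq_one_iff, forall_conj_mem_range_iff hinj hall he₀ h5 hθK hgen]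
    have hord : ∀ σ, orderOf (q σ) = orderOf (e₀ σ) := fun σ =>
      orderOf_eq_orderOf_iff.mpr fun n => by rw [← map_pow, ← map_pow, hker]
    have hA5 : alternatingGroup (Fin 5) ≤ q.range := by
      obtain ⟨σ₅, hσ₅⟩ := h5
      obtain ⟨σ₃, hσ₃⟩ := h3
      exact alternatingGroup_le_of_orderOf ⟨σ₅, rfl⟩ ⟨σ₃, rfl⟩ ((hord σ₅).trans hσ₅)
        ((hord σ₃).trans hσ₃)
    exact isIrreducible_hyperplane_of_alternating_le P q
      (fun σ i j => by rw [hq]; exact permRep_apply' K hK5 (PadicAlgCl ℓ) σ i j) hA5 ρ hρ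
  · -- geometric: unramified at `v ∣ ℓ` since `ℓ ≠ 1951`
    exact QuarterDeficit1951.isGeometricFramed_of_unramified_away hℓ RD ρ hunrρ
      (QuarterDeficit1951.eventually_isUnramifiedAt_of_away hunrρ)
  · -- Frobenius characteristic polynomials: Dedekind's theorem
    intro v hv
    refine ⟨hunrρ v hv, ?_⟩
    haveI := finite_heightOneSpectrum_under_eq (M := K) v
    haveI : Fintype {w : HeightOneSpectrum (𝓞 K) // w.under (𝓞 ℚ) = v} := Fintype.ofFinite _
    have hfrob := hasFrobCharpolyAt_permRep K hK5 (PadicAlgCl ℓ) (hI v hv)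
    obtain ⟨𝔓₁, h𝔓₁⟩ := HeightOneSpectrum.primesAbove_nonempty v
    obtain ⟨σ₁, hσ₁⟩ := HeightOneSpectrum.exists_isArithFrobAt_of_mem_primesAbove_holds h𝔓₁
    refine ⟨FramedRep.charpoly ρ σ₁, fun 𝔓 h𝔓 σ hσ => ?_, ?_⟩
    · have e1 := hchar σ
      rw [hfrob 𝔓 h𝔓 σ hσ, ← hfrob 𝔓₁ h𝔓₁ σ₁ hσ₁, ← hchar σ₁] at e1
      exact (monic_X_sub_C (1 : PadicAlgCl ℓ)).isRegular.left e1
    · rw [hchar σ₁, hfrob 𝔓₁ h𝔓₁ σ₁ hσ₁, prod_X_pow_sub_one_eq_map_prod K (PadicAlgCl ℓ) v]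

end Summit.Langlands.Langlands.Theorems.DedekindQuotient1951

end
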